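import Summits.CriticalPhenomena.PercolationContinuityZ3.Theorems.Transplant.SkelFrmFromBChoiceAtQT
import Summits.CriticalPhenomena.PercolationContinuityZ3.Theorems.Transplant.SkelFrmFromBChoiceLinksPx
import HarnessLib

/-!
# GEN ROW (WAVE-Us-MANIFEST v1.0 §3/§9, INPUT layer) «SkelFrmFromBChoiceAtQTPx» — the GENERALISED twin of «SkelFrmFromBChoiceAtQT»'s `h1`-lemmas (the inputs of
# `choiceAtQ3T` AT EVERY CENTRE) under `HasProxies t D` in place of `types = {t}` (hunk class 'h1 ↦ proxy package', option (a))

builds on p205010 (kernel theorem, internal audit signed; external expert review pending) — nothing in this file uses p205010.  Generated from the U twin by the hunk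
classes: binder `(h1 : Φ.types = {t}) ↦ (hP : Φ.HasProxies t D)` (+ the width floor `hn` of the delegated «AtQPx»/«KitPx»/«LinksPx» lemma), data
`O.merged.toDataN ↦ O.merged.toDataN.proxR hP.prox D`, zone `Λ c ↦ Λ (prox c)`, radius `RL ↦ RL + D`; every proof is the U twin's delegation through
`choiceAtQ3T_atQNQ_iff` to the corresponding `Px` lemma.  The `h1`-free lemmas of the U twin are used as they stand.  Nothing about any open node (U, U_s) is claimed.
[cite: KozmaNitzan2024, §4 pp. 19–21 ((21)–(25))] [this work]
-/

noncomputable section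

open scoped Classical

namespace Summit.CriticalPhenomena.PercolationContinuityZ3.Theorems.Transplant

open MeasureTheory Literature.Probability.Percolation Literature.Probability.LatticeModels SimpleGraph KNCells KNLevels
open SkelConc (Consts)
open Skelφ (oriφ trφ)
open Skelφ.StepI (DataN DataNS OutNS famSign)

namespace PlanarSkeletonFrmFrom

namespace NegB

open Neg

section AtQTPx

variable {κ : Consts} {V : Type} [DecidableEq V] [Countable V] {G : SimpleGraph V} [G.LocallyFinite] {Φ : PlanarSkeletonFrmFrom G} {t : V} {p : unitInterval}
  {hC : Φ.CylSubcritical p} {gv fv : Neg.FSlot} {Pv : PSlot} {Sv : SSlot} {cv : CSlot} {bv : BSlot} {O : OutNS V} {q : unitInterval} {D : ℕ}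
/-- [UNDER PROXIES: data `toDataN.proxR prox D` / zone `Λ ∘ prox` / radius `+ D`, width floor] (R-40) T twin at `choiceAtQ3T` (one-liner over the S lemma `inputsPAt_of_atQ`): **THE PIECE-LINKS OF ANY LISTED PAIR AT EVERY CENTRE `c`, SERVED QUADRANT** (`ChoiceNQ.inputsAt_of_atQNQ` at `choiceAtQ3`). [cite: KozmaNitzan2024, §4 pp. 19–21] -/
theorem inputsPAt_of_atQTPx (hAt : (choiceAtQ3T κ Φ t p Pv gv fv Sv cv bv hC).AtQNQ O q) (hP : Φ.HasProxies t D) (c : V) {M n : ℕ}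
    (hMn : (M, n) ∈ SMnP κ Φ t p O.merged (gOf κ Φ t p O gv) (fOf κ Φ t p O fv) Pv) (hn : D ≤ n) (fam : Fin 2) (τ : ℤˣ) :
    1 - δI3 κ Φ < (bondPercolation G q).real
      (Skelφ.StepI.eventNAt G (oriφ Φ.φ (O.ori t M n)) (O.merged.toDataN.proxR hP.prox D) t c (M, some (n, fam, Skelφ.StepI.sgQ O.qd O.qdT O.ori t M n fam, τ))) :=
  inputsPAt_of_atQPx (hAt := choiceAtQ3T_atQNQ_iff.1 hAt) (hP := hP) (hn := hn) (c := c) (hMn := hMn) (fam := fam) (τ := τ)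


/-- [UNDER PROXIES: data `toDataN.proxR prox D` / zone `Λ ∘ prox` / radius `+ D`, width floor] (R-40) T twin at `choiceAtQ3T` (one-liner over the S lemma `inputsExtraAt_of_atQ`): **The extra pairs' piece-links at every centre** (served quadrant). [this work] -/
theorem inputsExtraAt_of_atQTPx (hAt : (choiceAtQ3T κ Φ t p Pv gv fv Sv cv bv hC).AtQNQ O q) (hP : Φ.HasProxies t D) (c : V) {M n : ℕ} (hMn : (M, n) ∈ (Pv κ Φ t p O.merged).1) (hn : D ≤ n)
    (fam : Fin 2) (τ : ℤˣ) :
    1 - δI3 κ Φ < (bondPercolation G q).real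
      (Skelφ.StepI.eventNAt G (oriφ Φ.φ (O.ori t M n)) (O.merged.toDataN.proxR hP.prox D) t c (M, some (n, fam, Skelφ.StepI.sgQ O.qd O.qdT O.ori t M n fam, τ))) :=
  inputsExtraAt_of_atQPx (hAt := choiceAtQ3T_atQNQ_iff.1 hAt) (hP := hP) (hn := hn) (c := c) (hMn := hMn) (fam := fam) (τ := τ)


/-- [UNDER PROXIES: data `toDataN.proxR prox D` / zone `Λ ∘ prox` / radius `+ D`, width floor] (R-40) T twin at `choiceAtQ3T` (one-liner over the S lemma `inputsSAt_of_atQ`): **The short pair's piece-links at every centre, near sign `1`** (map `φS`). [cite: KozmaNitzan2024, §4 pp. 19–21] -/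
theorem inputsSAt_of_atQTPx (hAt : (choiceAtQ3T κ Φ t p Pv gv fv Sv cv bv hC).AtQNQ O q) (hP : Φ.HasProxies t D) (hn : D ≤ nS O.merged) (c : V) (fam : Fin 2) (τ : ℤˣ) :
    1 - δI3 κ Φ < (bondPercolation G q).real
      (Skelφ.StepI.eventNAt G (φS t O.D O.DT.toDataN O.ori (Φ := Φ)) (O.merged.toDataN.proxR hP.prox D) t c (Mu O.merged, some (nS O.merged, fam, 1, τ))) :=
  inputsSAt_of_atQPx (hAt := choiceAtQ3T_atQNQ_iff.1 hAt) (hP := hP) (hn := hn) (c := c) (fam := fam) (τ := τ)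


/-- [UNDER PROXIES: data `toDataN.proxR prox D` / zone `Λ ∘ prox` / radius `+ D`, width floor] (R-40) T twin at `choiceAtQ3T` (one-liner over the S lemma `inputsLAt_of_atQ`): **The long pair's piece-links at every centre, near sign `1`** (map `φL`). [cite: KozmaNitzan2024, §4 pp. 19–21] -/
theorem inputsLAt_of_atQTPx (hAt : (choiceAtQ3T κ Φ t p Pv gv fv Sv cv bv hC).AtQNQ O q) (hP : Φ.HasProxies t D) (hn : D ≤ nL κ Φ t p O.merged (gOf κ Φ t p O gv) (fOf κ Φ t p O fv)) (c : V) (fam : Fin 2) (τ : ℤˣ) :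
    1 - δI3 κ Φ < (bondPercolation G q).real
      (Skelφ.StepI.eventNAt G (φL κ Φ t p O.D O.DT.toDataN O.ori (gOf κ Φ t p O gv) (fOf κ Φ t p O fv)) (O.merged.toDataN.proxR hP.prox D) t c
        (ML κ Φ t p O.merged (gOf κ Φ t p O gv), some (nL κ Φ t p O.merged (gOf κ Φ t p O gv) (fOf κ Φ t p O fv), fam, 1, τ))) :=
  inputsLAt_of_atQPx (hAt := choiceAtQ3T_atQNQ_iff.1 hAt) (hP := hP) (hn := hn) (c := c) (fam := fam) (τ := τ)


/-- [UNDER PROXIES: data `toDataN.proxR prox D` / zone `Λ ∘ prox` / radius `+ D`, width floor] (R-40) T twin at `choiceAtQ3T` (one-liner over the S lemma `zoneAt_of_atQ`): **The uniqueness zone at `M_u` AT EVERY CENTRE** (`UniqZone.zone G (O.merged.Λ (hP.prox c)) O.merged.k M_u`; `UniqZone.zone` carries a `DecidableEq V` instance — the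
generic junction states it classically, this corollary at the section's instance, bridged by `convert`). [this work] -/
theorem zoneAt_of_atQTPx (hAt : (choiceAtQ3T κ Φ t p Pv gv fv Sv cv bv hC).AtQNQ O q) (hP : Φ.HasProxies t D) (c : V) :
    1 - δI3 κ Φ < (bondPercolation G q).real (UniqZone.zone G (O.merged.Λ (hP.prox c)) O.merged.k (Mu O.merged)) :=
  zoneAt_of_atQPx (hAt := choiceAtQ3T_atQNQ_iff.1 hAt) (hP := hP) (c := c)


/-- [UNDER PROXIES: data `toDataN.proxR prox D` / zone `Λ ∘ prox` / radius `+ D`, width floor] (R-40) T twin at `choiceAtQ3T` (one-liner over the S lemma `inputsLAt_cube_of_atQ`): **The long pair's piece-links at every centre at accuracy `1 − a³`** for any `a ≥ δkit` (e.g. `a := κ.δr 0` by `Neg.δkit_le_δr κ Φ (n := 0)`, `a := κ.δ₂` by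
`Neg.δkit_le_δ₂`) — the shape the (R)/(C)/(F) kit clauses' `hlong` binders consume. [cite: KozmaNitzan2024, §4 pp. 19–21] -/
theorem inputsLAt_cube_of_atQTPx (hAt : (choiceAtQ3T κ Φ t p Pv gv fv Sv cv bv hC).AtQNQ O q) (hP : Φ.HasProxies t D) (hn : D ≤ nL κ Φ t p O.merged (gOf κ Φ t p O gv) (fOf κ Φ t p O fv)) {a : ℝ} (ha : Neg.δkit κ Φ ≤ a) (c : V) (fam : Fin 2) (τ : ℤˣ) :
    1 - a ^ 3 < (bondPercolation G q).real
      (Skelφ.StepI.eventNAt G (φL κ Φ t p O.D O.DT.toDataN O.ori (gOf κ Φ t p O gv) (fOf κ Φ t p O fv)) (O.merged.toDataN.proxR hP.prox D) t c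
        (ML κ Φ t p O.merged (gOf κ Φ t p O gv), some (nL κ Φ t p O.merged (gOf κ Φ t p O gv) (fOf κ Φ t p O fv), fam, 1, τ))) :=
  inputsLAt_cube_of_atQPx (hAt := choiceAtQ3T_atQNQ_iff.1 hAt) (hP := hP) (hn := hn) (ha := ha) (c := c) (fam := fam) (τ := τ)


/-- [UNDER PROXIES: data `toDataN.proxR prox D` / zone `Λ ∘ prox` / radius `+ D`, width floor] (R-40) T twin at `choiceAtQ3T` (one-liner over the S lemma `inputsSAt_cube_of_atQ`): **The short pair's piece-links at every centre at accuracy `1 − a³`** (`a ≥ δkit`). [cite: KozmaNitzan2024, §4 pp. 19–21] -/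
theorem inputsSAt_cube_of_atQTPx (hAt : (choiceAtQ3T κ Φ t p Pv gv fv Sv cv bv hC).AtQNQ O q) (hP : Φ.HasProxies t D) (hn : D ≤ nS O.merged) {a : ℝ} (ha : Neg.δkit κ Φ ≤ a) (c : V) (fam : Fin 2) (τ : ℤˣ) :
    1 - a ^ 3 < (bondPercolation G q).real
      (Skelφ.StepI.eventNAt G (φS t O.D O.DT.toDataN O.ori (Φ := Φ)) (O.merged.toDataN.proxR hP.prox D) t c (Mu O.merged, some (nS O.merged, fam, 1, τ))) :=
  inputsSAt_cube_of_atQPx (hAt := choiceAtQ3T_atQNQ_iff.1 hAt) (hP := hP) (hn := hn) (ha := ha) (c := c) (fam := fam) (τ := τ)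


/-- [UNDER PROXIES: data `toDataN.proxR prox D` / zone `Λ ∘ prox` / radius `+ D`, width floor] (R-40) T twin at `choiceAtQ3T` (one-liner over the S lemma `inputsPAt_cube_of_atQ`): **Any listed pair's piece-links at every centre at accuracy `1 − a³`** (`a ≥ δkit`; served near sign; in particular the kit pair when `(MK, nKit) ∈ Pv`).
[cite: KozmaNitzan2024, §4 pp. 19–21] -/
theorem inputsPAt_cube_of_atQTPx (hAt : (choiceAtQ3T κ Φ t p Pv gv fv Sv cv bv hC).AtQNQ O q) (hP : Φ.HasProxies t D) {a : ℝ} (ha : Neg.δkit κ Φ ≤ a) (c : V) {M n : ℕ}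
    (hMn : (M, n) ∈ SMnP κ Φ t p O.merged (gOf κ Φ t p O gv) (fOf κ Φ t p O fv) Pv) (hn : D ≤ n) (fam : Fin 2) (τ : ℤˣ) :
    1 - a ^ 3 < (bondPercolation G q).real
      (Skelφ.StepI.eventNAt G (Skelφ.oriφ Φ.φ (O.ori t M n)) (O.merged.toDataN.proxR hP.prox D) t c (M, some (n, fam, Skelφ.StepI.sgQ O.qd O.qdT O.ori t M n fam, τ))) :=
  inputsPAt_cube_of_atQPx (hAt := choiceAtQ3T_atQNQ_iff.1 hAt) (hP := hP) (hn := hn) (ha := ha) (c := c) (hMn := hMn) (fam := fam) (τ := τ)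


/-- [UNDER PROXIES: data `toDataN.proxR prox D` / zone `Λ ∘ prox` / radius `+ D`, width floor] (R-40) T twin at `choiceAtQ3T` (one-liner over the S lemma `zoneAt_cube_of_atQ`): **The zone at every centre at accuracy `1 − a³`** (`a ≥ δkit`). [this work] -/
theorem zoneAt_cube_of_atQTPx (hAt : (choiceAtQ3T κ Φ t p Pv gv fv Sv cv bv hC).AtQNQ O q) (hP : Φ.HasProxies t D) {a : ℝ} (ha : Neg.δkit κ Φ ≤ a) (c : V) :
    1 - a ^ 3 < (bondPercolation G q).real (UniqZone.zone G (O.merged.Λ (hP.prox c)) O.merged.k (Mu O.merged)) :=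
  zoneAt_cube_of_atQPx (hAt := choiceAtQ3T_atQNQ_iff.1 hAt) (hP := hP) (ha := ha) (c := c)


/-- [UNDER PROXIES: data `toDataN.proxR prox D` / zone `Λ ∘ prox` / radius `+ D`, width floor] (R-40) T twin at `choiceAtQ3T` (one-liner over the S lemma `hlong_of_atQ3`): **`hlong` AT EVERY CENTRE, LITERAL SHAPE**: the long pair's side-half links at accuracy `1 − a³` (`a ≥ δkit`), zone at `M_u`, served sign `σ = 1`.
[cite: KozmaNitzan2024, §4 pp. 19–21] -/
theorem hlong_of_atQ3TPx (hAt : (choiceAtQ3T κ Φ t p Pv gv fv Sv cv bv hC).AtQNQ O q) (hP : Φ.HasProxies t D) (hn : D ≤ nL κ Φ t p O.merged (gOf κ Φ t p O gv) (fOf κ Φ t p O fv)) {a : ℝ} (ha : Neg.δkit κ Φ ≤ a) :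
    ∀ (c : V) (τ : ℤ), τ = 1 ∨ τ = -1 → 1 - a ^ 3 < (bondPercolation G q).real
      (linkIn (Skelφ.pgramPrism G (φL κ Φ t p O.D O.DT.toDataN O.ori (gOf κ Φ t p O gv) (fOf κ Φ t p O fv)) c
          (nL κ Φ t p O.merged (gOf κ Φ t p O gv) (fOf κ Φ t p O fv)) (hL κ Φ t p O.merged (gOf κ Φ t p O gv) (fOf κ Φ t p O fv))
          (3 * ℓL κ Φ t p O.merged (gOf κ Φ t p O gv) (fOf κ Φ t p O fv)) (RL κ Φ t p O gv fv + D))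
        (O.merged.Λ (hP.prox c) (Mu O.merged))
        (Skelφ.pgSideHalfW G (φL κ Φ t p O.D O.DT.toDataN O.ori (gOf κ Φ t p O gv) (fOf κ Φ t p O fv)) c
          (nL κ Φ t p O.merged (gOf κ Φ t p O gv) (fOf κ Φ t p O fv)) (hL κ Φ t p O.merged (gOf κ Φ t p O gv) (fOf κ Φ t p O fv))
          (ℓL κ Φ t p O.merged (gOf κ Φ t p O gv) (fOf κ Φ t p O fv)) (RL κ Φ t p O gv fv + D) 1 (1 * τ))) :=
  hlong_of_atQ3Px (hAt := choiceAtQ3T_atQNQ_iff.1 hAt) (hP := hP) (hn := hn) (ha := ha)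


/-- [UNDER PROXIES: data `toDataN.proxR prox D` / zone `Λ ∘ prox` / radius `+ D`, width floor] (R-40) T twin at `choiceAtQ3T` (one-liner over the S lemma `hlongY_of_atQ3`): **`hlongY` AT EVERY CENTRE, LITERAL SHAPE**: the long pair's top-piece links at accuracy `1 − a³`, zone at `M_u`, served sign `σ = 1`, split point `vL`.
[cite: KozmaNitzan2024, §4 pp. 19–21] -/
theorem hlongY_of_atQ3TPx (hAt : (choiceAtQ3T κ Φ t p Pv gv fv Sv cv bv hC).AtQNQ O q) (hP : Φ.HasProxies t D) (hn : D ≤ nL κ Φ t p O.merged (gOf κ Φ t p O gv) (fOf κ Φ t p O fv)) {a : ℝ} (ha : Neg.δkit κ Φ ≤ a) :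
    ∀ (c : V) (τ : ℤ), τ = 1 ∨ τ = -1 → 1 - a ^ 3 < (bondPercolation G q).real
      (linkIn (Skelφ.pgramPrism G (φL κ Φ t p O.D O.DT.toDataN O.ori (gOf κ Φ t p O gv) (fOf κ Φ t p O fv)) c
          (nL κ Φ t p O.merged (gOf κ Φ t p O gv) (fOf κ Φ t p O fv)) (hL κ Φ t p O.merged (gOf κ Φ t p O gv) (fOf κ Φ t p O fv))
          (3 * ℓL κ Φ t p O.merged (gOf κ Φ t p O gv) (fOf κ Φ t p O fv)) (RL κ Φ t p O gv fv + D))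
        (O.merged.Λ (hP.prox c) (Mu O.merged))
        (Skelφ.pgTopPieceW G (φL κ Φ t p O.D O.DT.toDataN O.ori (gOf κ Φ t p O gv) (fOf κ Φ t p O fv)) c
          (nL κ Φ t p O.merged (gOf κ Φ t p O gv) (fOf κ Φ t p O fv)) (hL κ Φ t p O.merged (gOf κ Φ t p O gv) (fOf κ Φ t p O fv))
          (ℓL κ Φ t p O.merged (gOf κ Φ t p O gv) (fOf κ Φ t p O fv)) (RL κ Φ t p O gv fv + D) 1 τ
          (vL κ Φ t p O.merged (gOf κ Φ t p O gv) (fOf κ Φ t p O fv)))) :=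
  hlongY_of_atQ3Px (hAt := choiceAtQ3T_atQNQ_iff.1 hAt) (hP := hP) (hn := hn) (ha := ha)

end AtQTPx

end NegB

end PlanarSkeletonFrmFrom

end Summit.CriticalPhenomena.PercolationContinuityZ3.Theorems.Transplant

end
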